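/-
Copyright (c) 2026. Released under Apache 2.0 license.
-/
import Literature.NumberTheory.Automorphic.UnboundedDenominatorsInvariantHomPrimeLevel
import Mathlib.FieldTheory.Finite.GaloisField
import Mathlib.Algebra.GroupWithZero.Units.Fintype
import HarnessLib

/-!
# The invariant form of CDT Cor. 4.5.3 at prime level `p`: targets of odd order

The non-split Cartan subgroup of `SL₂(𝔽_p)`: the regular representation of `𝔽_{p²}` over `𝔽_p` turns a
generator `ζ` of `𝔽_{p²}ˣ` into a matrix whose `(p-1)`-st power lies in `SL₂(𝔽_p)` and has order `p + 1`
(`exists_zpowers_index_eq_mul_pred`: a cyclic subgroup of index `p(p - 1)`).  With the cyclic-subgroup case of the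
transfer reduction (`UnboundedDenominatorsInvariantHomCyclic`) this handles the targets of prime-power order
`ℓ^a` with `ℓ` odd, `ℓ ∣ p + 1`; together with `Γ₁(p)` (`ℓ = p`) and the split Cartan (`ℓ ∤ p(p+1)`) and a
prime-by-prime gluing we obtain:

* `cor453_invariant_form_prime_level_of_odd` — **for a prime `p` and a finite commutative group `Q` of ODD order,
  every `SL₂(ℤ)`-conjugation-invariant homomorphism `θ : Γ(p) → Q` is trivial on `Γ(12p)`**;
* `cor453_invariant_form_prime_level_prime_target'` — invariant classes in `H¹(Γ(p), 𝐅_ℓ)` are congruence of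
  level `12p` for every ODD prime `ℓ` (and for `ℓ = 2` when `p = 2`).

The one remaining case at prime level is `ℓ = 2`, `p` odd (quaternion Sylow `2`-subgroups: the dicyclic
normaliser of a Cartan subgroup of odd index), see the crux memo `Lines/cdt_thm1-hcor-structure-g40.md`.
[cite: CalegariDimitrovTang2025, Corollary 4.5.3]
-/

open scoped MatrixGroups

namespace Literature.NumberTheory.Automorphic

namespace UnboundedDenominators

open CongruenceSubgroup Matrix.SpecialLinearGroup ModularGroup
open Literature.NumberTheory.EllipticCurves.ModularForms (Gamma_le_Gamma1 index_Gamma_eq_card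
  index_Gamma_eq_mul)

variable {Q : Type*} [CommGroup Q]

/-! ### The non-split Cartan subgroup -/

/-- **The non-split Cartan subgroup of `SL₂(𝔽_p)`**: there is `c̄ ∈ SL₂(ℤ/p)` of order `p + 1`, i.e. with
`[SL₂(ℤ/p) : ⟨c̄⟩] = p (p - 1)` — the `(p-1)`-st power of (the matrix, in an `𝔽_p`-basis of `𝔽_{p²}`, of
multiplication by) a generator of `𝔽_{p²}ˣ`. [cite: DiamondShurman2005, §1.2 and Exercise 1.2.3] -/
theorem exists_zpowers_index_eq_mul_pred {p : ℕ} (hp : p.Prime) :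
    ∃ cbar : SL(2, ZMod p), (Subgroup.zpowers cbar).index = p * (p - 1) := by
  classical
  haveI : Fact p.Prime := ⟨hp⟩
  -- `𝔽_{p²}` with an `𝔽_p`-basis indexed by `Fin 2`
  let F := GaloisField p 2
  haveI : Fintype F := Fintype.ofFinite F
  let b : Module.Basis (Fin 2) (ZMod p) F :=
    Module.finBasisOfFinrankEq (ZMod p) F (GaloisField.finrank p two_ne_zero)
  let L : F →ₐ[ZMod p] Matrix (Fin 2) (Fin 2) (ZMod p) := Algebra.leftMulMatrix b
  have hL : Function.Injective L := Algebra.leftMulMatrix_injective b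
  -- a generator of `𝔽_{p²}ˣ`, of order `p² - 1`
  obtain ⟨ζ, hζ⟩ := IsCyclic.exists_generator (α := Fˣ)
  have hcardF : Nat.card F = p ^ 2 := GaloisField.card p 2 two_ne_zero
  have hordζ : orderOf (ζ : F) = p ^ 2 - 1 := by
    rw [orderOf_units, orderOf_eq_card_of_forall_mem_zpowers hζ, Nat.card_units, hcardF]
  -- the matrix of `ζ` and its `(p-1)`-st power
  set M : Matrix (Fin 2) (Fin 2) (ZMod p) := L (ζ : F) with hM
  have hordM : orderOf M = p ^ 2 - 1 := by
    have h := orderOf_injective (L : F →* Matrix (Fin 2) (Fin 2) (ZMod p)) hL (ζ : F)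
    rw [MonoidHom.coe_coe] at h
    rw [hM, h, hordζ]
  have hdetM : M.det ≠ 0 := by
    have h : M.det * (L ((ζ⁻¹ : Fˣ) : F)).det = 1 := by
      rw [← Matrix.det_mul, hM, ← map_mul, Units.mul_inv, map_one, Matrix.det_one]
    exact (IsUnit.of_mul_eq_one _ h).ne_zero
  have hdet : (M ^ (p - 1)).det = 1 := by
    rw [Matrix.det_pow, ZMod.pow_card_sub_one_eq_one hdetM]
  let cbar : SL(2, ZMod p) := ⟨M ^ (p - 1), hdet⟩
  refine ⟨cbar, ?_⟩
  -- the order of `c̄` is `p + 1`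
  have hp1 : p - 1 ≠ 0 := (Nat.sub_pos_of_lt hp.one_lt).ne'
  have hsq : p ^ 2 - 1 = (p + 1) * (p - 1) := by
    have := hp.one_le
    zify [this, Nat.one_le_pow 2 p hp.pos]
    ring
  have hordMp : orderOf (M ^ (p - 1)) = p + 1 := by
    rw [orderOf_pow_of_dvd hp1 (by rw [hordM, hsq]; exact dvd_mul_left _ _), hordM, hsq,
      Nat.mul_div_cancel _ (Nat.pos_of_ne_zero hp1)]
  let ι : SL(2, ZMod p) →* Matrix (Fin 2) (Fin 2) (ZMod p) :=
    { toFun := fun A ↦ (A : Matrix (Fin 2) (Fin 2) (ZMod p))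
      map_one' := Matrix.SpecialLinearGroup.coe_one
      map_mul' := fun A B ↦ Matrix.SpecialLinearGroup.coe_mul A B }
  have hι : Function.Injective ι := fun A B h ↦ Subtype.ext h
  have hord : orderOf cbar = p + 1 := by
    rw [← orderOf_injective ι hι cbar]
    exact hordMp
  -- index = `|SL₂(𝔽_p)| / (p + 1) = p (p - 1)`
  have hcard : Nat.card SL(2, ZMod p) = p * ((p + 1) * (p - 1)) := by
    haveI : NeZero p := ⟨hp.ne_zero⟩
    rw [← index_Gamma_eq_card, index_Gamma_eq_mul, index_Gamma1_prime hp]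
  have h := (Subgroup.zpowers cbar).index_mul_card
  rw [Nat.card_zpowers, hord, hcard, mul_left_comm, mul_comm] at h
  exact Nat.eq_of_mul_eq_mul_left (Nat.succ_pos p) h

/-! ### Prime level, odd targets -/

/-- Gluing lemma: if `q^n = 1` and `q^{n/ℓ^{v_ℓ(n)}} = 1` for every prime `ℓ ∣ n`, then `q = 1`. [folklore] -/
private theorem eq_one_of_forall_pow_ordCompl {q : Q} {n : ℕ} (hn : n ≠ 0) (hq : q ^ n = 1)
    (h : ∀ ℓ : ℕ, ℓ.Prime → ℓ ∣ n → q ^ (ordCompl[ℓ] n) = 1) : q = 1 := by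
  by_contra hne
  have hord : orderOf q ≠ 1 := fun h1 ↦ hne (orderOf_eq_one_iff.mp h1)
  obtain ⟨ℓ, hℓ, hℓq⟩ := Nat.exists_prime_and_dvd hord
  have hℓn : ℓ ∣ n := hℓq.trans (orderOf_dvd_of_pow_eq_one hq)
  have h1 : ℓ ∣ ordCompl[ℓ] n := hℓq.trans (orderOf_dvd_of_pow_eq_one (h ℓ hℓ hℓn))
  have h2 : Nat.Coprime ℓ (ordCompl[ℓ] n) := Nat.coprime_ordCompl hℓ hn
  exact hℓ.one_lt.ne' (Nat.Coprime.eq_one_of_dvd h2 h1)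

/-- **Invariant form of CDT Cor. 4.5.3 at prime level `p`, targets of ODD order**: every `SL₂(ℤ)`-conjugation
invariant `θ : Γ(p) → Q` (`Q` finite commutative of odd order) is trivial on `Γ(12p)`.  Prime by prime in `|Q|`:
`ℓ = p` is handled by `Γ₁(p)`, `ℓ ∤ p(p+1)` by the split Cartan subgroup, odd `ℓ ∣ p + 1` (so `ℓ ∤ p(p-1)`) by
the non-split Cartan subgroup. [cite: CalegariDimitrovTang2025, Corollary 4.5.3] -/
theorem cor453_invariant_form_prime_level_of_odd {p : ℕ} (hp : p.Prime) (Q : Type*) [CommGroup Q] [Finite Q]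
    (hQ : Odd (Nat.card Q)) (θ : Gamma p →* Q)
    (hθ : ∀ (g x : SL(2, ℤ)) (hx : x ∈ Gamma p) (hgx : g * x * g⁻¹ ∈ Gamma p),
      θ ⟨g * x * g⁻¹, hgx⟩ = θ ⟨x, hx⟩) :
    ∀ (x : SL(2, ℤ)) (hx : x ∈ Gamma p), x ∈ Gamma (12 * p) → θ ⟨x, hx⟩ = 1 := by
  haveI : NeZero p := ⟨hp.ne_zero⟩
  haveI : Fact p.Prime := ⟨hp⟩
  intro x hx hx12
  set n : ℕ := Nat.card Q with hn
  have hn0 : n ≠ 0 := Nat.card_pos.ne'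
  have hinv : ∀ k : ℕ, ∀ (g y : SL(2, ℤ)) (hy : y ∈ Gamma p) (hgy : g * y * g⁻¹ ∈ Gamma p),
      ((powMonoidHom k).comp θ) ⟨g * y * g⁻¹, hgy⟩ = ((powMonoidHom k).comp θ) ⟨y, hy⟩ := by
    intro k g y hy hgy
    simp only [MonoidHom.comp_apply, hθ g y hy hgy]
  have hpow : ∀ (k : ℕ) (y : Gamma p), ((powMonoidHom k).comp θ) y = θ y ^ k := fun k y ↦ rfl
  refine eq_one_of_forall_pow_ordCompl hn0 (hn ▸ pow_card_eq_one') fun ℓ hℓ hℓn ↦ ?_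
  -- `θ^{m}` with `m = n / ℓ^{v_ℓ(n)}` has exponent `ℓ^{v_ℓ(n)}`
  set e : ℕ := ordProj[ℓ] n with he_def
  set m : ℕ := ordCompl[ℓ] n with hm_def
  have hnm : e * m = n := Nat.ordProj_mul_ordCompl_eq_self n ℓ
  have he : ∀ y : Gamma p, ((powMonoidHom m).comp θ) y ^ e = 1 := by
    intro y
    rw [hpow, ← pow_mul, mul_comm, hnm, hn]
    exact pow_card_eq_one'
  have hℓ2 : ℓ ≠ 2 := by
    rintro rfl
    exact (Nat.not_even_iff_odd.mpr hQ) (even_iff_two_dvd.mpr hℓn)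
  suffices h : ((powMonoidHom m).comp θ) ⟨x, hx⟩ = 1 by rwa [hpow] at h
  haveI := ker_map_subtype_normal ((powMonoidHom m).comp θ) (hinv m)
  by_cases hℓp : ℓ = p
  · -- `ℓ = p`: the subgroup `Γ₁(p)` of index `(p+1)(p-1)`
    have hcop : e.Coprime (Gamma1 p).index := by
      rw [he_def, hℓp, index_Gamma1_prime hp]
      refine Nat.Coprime.pow_left _ (Nat.Coprime.mul_right ?_ ?_)
      · exact Nat.coprime_self_add_right.mpr (Nat.coprime_one_right p)
      · have h : p = 1 + (p - 1) := (Nat.add_sub_cancel' hp.one_le).symm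
        conv_lhs => rw [h]
        exact Nat.coprime_add_self_left.mpr (Nat.coprime_one_left _)
    exact map_eq_one_of_mem_Gamma_mul_of_local_of_pow_eq_one ((powMonoidHom m).comp θ) (hinv m)
      (Gamma1 p) (Gamma_le_Gamma1 p) he hcop (fun y hy hyc ↦ by
        rw [sup_eq_right.mpr (commutator_Gamma1_le_ker _ (hinv m))] at hyc
        obtain ⟨_, h⟩ := (mem_ker_map_subtype_iff _).mp hyc
        exact h) x hx hx12
  · have hℓp' : Nat.Coprime ℓ p := (Nat.coprime_primes hℓ hp).mpr hℓp
    by_cases hℓs : ℓ ∣ p + 1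
    · -- odd `ℓ ∣ p + 1`: the non-split Cartan subgroup, of index `p (p - 1)`
      have hℓd : ¬ ℓ ∣ p - 1 := by
        intro hd
        have h2 : ℓ ∣ (p + 1) - (p - 1) := Nat.dvd_sub hℓs hd
        have : (p + 1) - (p - 1) = 2 := by have := hp.one_le; omega
        rw [this] at h2
        exact hℓ2 ((Nat.prime_dvd_prime_iff_eq hℓ Nat.prime_two).mp h2)
      obtain ⟨cbar, hcbar⟩ := exists_zpowers_index_eq_mul_pred hp
      have hcop : e.Coprime (Subgroup.zpowers cbar).index := by
        rw [hcbar, he_def]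
        exact Nat.Coprime.pow_left _
          (Nat.Coprime.mul_right hℓp' ((Nat.Prime.coprime_iff_not_dvd hℓ).mpr hℓd))
      exact map_eq_one_of_mem_Gamma_mul_of_zpowers_of_pow_eq_one ((powMonoidHom m).comp θ) (hinv m)
        cbar he hcop x hx hx12
    · -- `ℓ ∤ p (p + 1)`: the split Cartan subgroup, of index `p (p + 1)`
      obtain ⟨cbar, hcbar⟩ := exists_zpowers_index_eq_mul_succ hp
      have hcop : e.Coprime (Subgroup.zpowers cbar).index := by
        rw [hcbar, he_def]
        exact Nat.Coprime.pow_left _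
          (Nat.Coprime.mul_right hℓp' ((Nat.Prime.coprime_iff_not_dvd hℓ).mpr hℓs))
      exact map_eq_one_of_mem_Gamma_mul_of_zpowers_of_pow_eq_one ((powMonoidHom m).comp θ) (hinv m)
        cbar he hcop x hx hx12

/-- The odd-order prime-level case in the exact shape of the invariant form (`M = 12p`).
[cite: CalegariDimitrovTang2025, Corollary 4.5.3] -/
theorem cor453_invariant_form_prime_level_of_odd' {p : ℕ} (hp : p.Prime) (Q : Type*) [CommGroup Q]
    [Finite Q] (hQ : Odd (Nat.card Q)) (θ : Gamma p →* Q)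
    (hθ : ∀ (g x : SL(2, ℤ)) (hx : x ∈ Gamma p) (hgx : g * x * g⁻¹ ∈ Gamma p),
      θ ⟨g * x * g⁻¹, hgx⟩ = θ ⟨x, hx⟩) :
    ∃ M : ℕ, M ≠ 0 ∧ ∀ (x : SL(2, ℤ)) (hx : x ∈ Gamma p), x ∈ Gamma M → θ ⟨x, hx⟩ = 1 :=
  ⟨12 * p, Nat.mul_ne_zero (by norm_num) hp.ne_zero, cor453_invariant_form_prime_level_of_odd hp Q hQ θ hθ⟩

/-- **Invariant classes in `H¹(Γ(p), 𝐅_ℓ)` are congruence (level `12p`) for every odd prime `ℓ`**, and for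
`ℓ = 2` when `p = 2`; i.e. for all `(p, ℓ)` except `ℓ = 2 < p`. [cite: CalegariDimitrovTang2025, Corollary 4.5.3] -/
theorem cor453_invariant_form_prime_level_prime_target' {p ℓ : ℕ} (hp : p.Prime) (hℓ : ℓ.Prime)
    (hℓ2 : ℓ = 2 → p = 2) (C : Type*) [CommGroup C] [Finite C] (hC : Nat.card C = ℓ) (θ : Gamma p →* C)
    (hθ : ∀ (g x : SL(2, ℤ)) (hx : x ∈ Gamma p) (hgx : g * x * g⁻¹ ∈ Gamma p),
      θ ⟨g * x * g⁻¹, hgx⟩ = θ ⟨x, hx⟩) :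
    ∀ (x : SL(2, ℤ)) (hx : x ∈ Gamma p), x ∈ Gamma (12 * p) → θ ⟨x, hx⟩ = 1 := by
  rcases hℓ.eq_two_or_odd' with rfl | hodd
  · obtain rfl := hℓ2 rfl
    exact cor453_invariant_form_prime_level_prime_target Nat.prime_two Nat.prime_two (by decide) C hC θ hθ
  · exact cor453_invariant_form_prime_level_of_odd hp C (hC ▸ hodd) θ hθ

end UnboundedDenominators

end Literature.NumberTheory.Automorphic
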